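import Summits.SmoothPoincare4.SmoothPoincare4.Theses.EntropyRung
import Summits.SmoothPoincare4.SmoothPoincare4.Theorems.EntropyRungSubcylindricalExistenceEntropyLocalisation
import Summits.SmoothPoincare4.SmoothPoincare4.Theorems.EntropyRungSubcylindricalExistenceEntropyLocalisationFinite
import Summits.SmoothPoincare4.SmoothPoincare4.Theorems.EntropyRungSubcylindricalExistenceWeightComparison
import Literature.Geometry.Riemannian.BakryEmeryHeatFlow
import Literature.Geometry.Riemannian.PerelmanEntropyCutoff
import Literature.Geometry.Riemannian.CanonicalNeighbourhoodScaling
import HarnessLib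

/-!
# The localisation principle for the weighted `𝒲`-clause (helper L1 `helper_localisationPrinciple`,
# line `fat-conical-core-avr-logsobolev`, crux `EntropyRung.SubcylindricalExistence`, stmt-SmoothPoincare4-10871)

Weighted conventions on a closed Riemannian 4-manifold `(M, g)` (Levi-Civita) of the summit binder:
weight `Φ > 0` smooth, potential `r ≥ 0` continuous, `c_τ = (4πτ)⁻²`, and for a smooth `v`
`F(v, τ) = ∫ (τ (r v² + 4 Φ⁻²|∇v|²) − v² log v² − 4 v²) c_τ Φ⁴ dV_g`, mass `m(v, τ) = ∫ c_τ v² Φ⁴`.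
**`helper_localisationPrinciple`:** for a smooth partition `Σⱼ χⱼ² = 1` (`j ≤ n`) whose cut-off
cost is absorbed, `4 ∫ u² Φ² Σⱼ|∇χⱼ|² ≤ β ∫ (4Φ²|∇u|² + rΦ⁴u²)` (`0 ≤ β < 1`), and piece floors
`Lⱼ ≤ F(v, σ)` at every scale for normalised `v` living where `χⱼ ≠ 0`, the whole clause holds at
level `minⱼ Lⱼ + 2 log(1 − β)` at every scale.

Proof. With `A(v) = ∫(4Φ²|∇v|² + rΦ⁴v²)`, `E(v) = ∫ v² log v² Φ⁴`, `N(v) = ∫ v²Φ⁴`: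
`F(v, τ) = τ c A(v) − c E(v) − 4 c N(v)` (`integral_density_split`); the finite IMS formula
(`EntropyLocalisationFinite.gradSq_localisation_sum`) gives `Σⱼ A(χⱼw) = A(w) + cost`,
`Σⱼ E(χⱼw) = E(w) + Σⱼ ∫ w²Φ⁴χⱼ² log χⱼ²`, `Σⱼ N(χⱼw) = N(w)`; Jensen for `s log s` and the
probability measure `c w² Φ⁴ dV` pays the mixing entropy (`mass_mul_log_le`); absorption gives
`τ c · cost ≤ β Σⱼ τ c A(χⱼw)`; and each piece obeys
`mⱼ (Lⱼ + 2 log θ) ≤ θ τ c A(χⱼw) − c E(χⱼw) − 4 mⱼ + mⱼ log mⱼ`, `θ = 1 − β` (`piece_bound`: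
normalise `θ χⱼw/√mⱼ` at the shifted scale `θτ`, where `c_{θτ} = c_τ/θ²`). Summing with
`Σⱼ mⱼ = 1` gives the claim. References: Cycon–Froese–Kirsch–Simon, *Schrödinger Operators* (1987),
Thm. 3.2 (IMS localisation); Perelman 2002, §3 (scaling of `𝒲`). Everything is proved; no
definitions, no named facts.
-/

noncomputable section

-- the registered namespace `Summit.SmoothPoincare4.SmoothPoincare4.Theorems` repeats a component
set_option linter.dupNamespace false

open scoped Manifold ContDiff Topology ENNReal NNReal
open Set Filter MeasureTheory
open Literature.Geometry.Lorentzian Literature.Geometry.Riemannian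

namespace Summit.SmoothPoincare4.SmoothPoincare4.Theorems

namespace LocalisationPrincipleAux

variable {M : Type} [TopologicalSpace M]
  [ChartedSpace (EuclideanSpace ℝ (Fin 4)) M] [IsManifold (𝓡 4) ∞ M]
  (g : PseudoRiemannianMetric (𝓡 4) ∞ (EuclideanSpace ℝ (Fin 4)) (TangentSpace (𝓡 4) : M → Type _))

/-! ### Continuity of the densities -/

/-- The weighted Dirichlet–curvature density `4Φ²|∇v|² + rΦ⁴v²` is continuous. -/
theorem continuous_quadForm {Φ r v : M → ℝ} (hΦ : ContMDiff (𝓡 4) 𝓘(ℝ, ℝ) ∞ Φ) (hr : Continuous r)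
    (hv : ContMDiff (𝓡 4) 𝓘(ℝ, ℝ) ∞ v) :
    Continuous fun x ↦ 4 * (Φ x ^ 2 * g.gradSq v x) + r x * Φ x ^ 4 * v x ^ 2 := by
  have hG : Continuous (g.gradSq v) := (contMDiff_gradSq g hv).continuous
  exact (continuous_const.mul ((hΦ.continuous.pow 2).mul hG)).add ((hr.mul (hΦ.continuous.pow 4)).mul (hv.continuous.pow 2))

omit [ChartedSpace (EuclideanSpace ℝ (Fin 4)) M] [IsManifold (𝓡 4) ∞ M] in
/-- The weighted entropy density `v² log v² Φ⁴` is continuous. -/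
theorem continuous_entForm {Φ v : M → ℝ} (hΦ : Continuous Φ) (hv : Continuous v) :
    Continuous fun x ↦ (v x) ^ 2 * Real.log ((v x) ^ 2) * (Φ x) ^ 4 :=
  (Real.continuous_mul_log.comp (hv.pow 2)).mul (hΦ.pow 4)

omit [ChartedSpace (EuclideanSpace ℝ (Fin 4)) M] [IsManifold (𝓡 4) ∞ M] in
/-- The weighted mass density `v² Φ⁴` is continuous. -/
theorem continuous_massForm {Φ v : M → ℝ} (hΦ : Continuous Φ) (hv : Continuous v) :
    Continuous fun x ↦ (v x) ^ 2 * (Φ x) ^ 4 :=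
  (hv.pow 2).mul (hΦ.pow 4)

section Integral

variable [CompactSpace M] [T3Space M] [MeasurableSpace M] [BorelSpace M]

/-- Splitting of the weighted functional into its Dirichlet–curvature, entropy and mass parts:
`∫ dens(v, σ, k) = σ k ∫(4Φ²|∇v|² + rΦ⁴v²) − k ∫ v² log v² Φ⁴ − 4k ∫ v²Φ⁴`. -/
theorem integral_density_split (hg : g.IsRiemannian) {Φ r v : M → ℝ}
    (hΦ : ContMDiff (𝓡 4) 𝓘(ℝ, ℝ) ∞ Φ) (hΦpos : ∀ x, 0 < Φ x) (hr : Continuous r)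
    (hv : ContMDiff (𝓡 4) 𝓘(ℝ, ℝ) ∞ v) (σ k : ℝ) :
    ∫ x, (σ * (r x * (v x) ^ 2 + 4 * ((Φ x)⁻¹ ^ 2 * g.gradSq v x)) - (v x) ^ 2 * Real.log ((v x) ^ 2) - 4 * (v x) ^ 2)
        * (k * (Φ x) ^ 4) ∂(riemannianMeasure (g.toContMDiffRiemannianMetric hg))
      = σ * k * ∫ x, (4 * (Φ x ^ 2 * g.gradSq v x) + r x * Φ x ^ 4 * v x ^ 2) ∂(riemannianMeasure (g.toContMDiffRiemannianMetric hg))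
        - k * ∫ x, (v x) ^ 2 * Real.log ((v x) ^ 2) * (Φ x) ^ 4 ∂(riemannianMeasure (g.toContMDiffRiemannianMetric hg))
        - 4 * k * ∫ x, (v x) ^ 2 * (Φ x) ^ 4 ∂(riemannianMeasure (g.toContMDiffRiemannianMetric hg)) := by
  set μ : Measure M := riemannianMeasure (g.toContMDiffRiemannianMetric hg)
  have hpt : ∀ x, (σ * (r x * (v x) ^ 2 + 4 * ((Φ x)⁻¹ ^ 2 * g.gradSq v x)) - (v x) ^ 2 * Real.log ((v x) ^ 2) - 4 * (v x) ^ 2)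
        * (k * (Φ x) ^ 4) = σ * k * (4 * (Φ x ^ 2 * g.gradSq v x) + r x * Φ x ^ 4 * v x ^ 2)
        - k * ((v x) ^ 2 * Real.log ((v x) ^ 2) * (Φ x) ^ 4) - 4 * k * ((v x) ^ 2 * (Φ x) ^ 4) := by
    intro x
    have hΦx : Φ x ≠ 0 := (hΦpos x).ne'
    field_simp
    ring
  have hIA : Integrable (fun x ↦ σ * k * (4 * (Φ x ^ 2 * g.gradSq v x) + r x * Φ x ^ 4 * v x ^ 2)) μ :=
    (EntropyLocalisation.integrable_of_continuous g hg (continuous_quadForm g hΦ hr hv)).const_mul _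
  have hIE : Integrable (fun x ↦ k * ((v x) ^ 2 * Real.log ((v x) ^ 2) * (Φ x) ^ 4)) μ :=
    (EntropyLocalisation.integrable_of_continuous g hg (continuous_entForm hΦ.continuous hv.continuous)).const_mul _
  have hIN : Integrable (fun x ↦ 4 * k * ((v x) ^ 2 * (Φ x) ^ 4)) μ :=
    (EntropyLocalisation.integrable_of_continuous g hg (continuous_massForm hΦ.continuous hv.continuous)).const_mul _
  rw [integral_congr_ae (ae_of_all _ hpt), integral_sub (hIA.sub' hIE) hIN, integral_sub hIA hIE, integral_const_mul,
    integral_const_mul, integral_const_mul]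

/-- **The per-piece bound with the scale shift `τ ↦ θτ`.** For a smooth `v` living where `χ₀ ≠ 0`,
if the weighted clause holds at level `Lj` at every scale for test functions living where
`χ₀ ≠ 0`, then with `c = (4πτ)⁻²`, `m = c ∫ v²Φ⁴`, `A = ∫(4Φ²|∇v|² + rΦ⁴v²)`,
`E = ∫ v² log v² Φ⁴`: `m (Lj + 2 log θ) ≤ θ τ c A − c E − 4 m + m log m` (normalise `θ v/√m` at
scale `θτ`; the case `m = 0` is `v = 0` a.e.). -/
theorem piece_bound (hg : g.IsRiemannian) {Φ r v χ₀ : M → ℝ}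
    (hΦ : ContMDiff (𝓡 4) 𝓘(ℝ, ℝ) ∞ Φ) (hΦpos : ∀ x, 0 < Φ x) (hr : Continuous r)
    (hr0 : ∀ x, 0 ≤ r x) (hv : ContMDiff (𝓡 4) 𝓘(ℝ, ℝ) ∞ v) (hsupp : ∀ x, v x ≠ 0 → χ₀ x ≠ 0)
    {τ θ Lj : ℝ} (hτ : 0 < τ) (hθ : 0 < θ)
    (hfloor : ∀ σ : ℝ, 0 < σ → ∀ u : M → ℝ, ContMDiff (𝓡 4) 𝓘(ℝ, ℝ) ∞ u → (∀ x, u x ≠ 0 → χ₀ x ≠ 0) →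
        ∫ x, (4 * Real.pi * σ) ^ (-(4 : ℝ) / 2) * (u x) ^ 2 * (Φ x) ^ 4 ∂(riemannianMeasure (g.toContMDiffRiemannianMetric hg)) = 1 →
          Lj ≤ ∫ x, (σ * (r x * (u x) ^ 2 + 4 * ((Φ x)⁻¹ ^ 2 * g.gradSq u x)) - (u x) ^ 2 * Real.log ((u x) ^ 2)
            - 4 * (u x) ^ 2) * ((4 * Real.pi * σ) ^ (-(4 : ℝ) / 2) * (Φ x) ^ 4) ∂(riemannianMeasure (g.toContMDiffRiemannianMetric hg))) :
    ((4 * Real.pi * τ) ^ (-(4 : ℝ) / 2) * ∫ x, (v x) ^ 2 * (Φ x) ^ 4 ∂(riemannianMeasure (g.toContMDiffRiemannianMetric hg))) * (Lj + 2 * Real.log θ) ≤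
      θ * (τ * (4 * Real.pi * τ) ^ (-(4 : ℝ) / 2) *
          ∫ x, (4 * (Φ x ^ 2 * g.gradSq v x) + r x * Φ x ^ 4 * v x ^ 2) ∂(riemannianMeasure (g.toContMDiffRiemannianMetric hg)))
        - (4 * Real.pi * τ) ^ (-(4 : ℝ) / 2) * ∫ x, (v x) ^ 2 * Real.log ((v x) ^ 2) * (Φ x) ^ 4 ∂(riemannianMeasure (g.toContMDiffRiemannianMetric hg))
        - 4 * ((4 * Real.pi * τ) ^ (-(4 : ℝ) / 2) * ∫ x, (v x) ^ 2 * (Φ x) ^ 4 ∂(riemannianMeasure (g.toContMDiffRiemannianMetric hg)))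
        + ((4 * Real.pi * τ) ^ (-(4 : ℝ) / 2) * ∫ x, (v x) ^ 2 * (Φ x) ^ 4 ∂(riemannianMeasure (g.toContMDiffRiemannianMetric hg))) *
          Real.log ((4 * Real.pi * τ) ^ (-(4 : ℝ) / 2) * ∫ x, (v x) ^ 2 * (Φ x) ^ 4 ∂(riemannianMeasure (g.toContMDiffRiemannianMetric hg))) := by
  set μ : Measure M := riemannianMeasure (g.toContMDiffRiemannianMetric hg) with hμ
  set c : ℝ := (4 * Real.pi * τ) ^ (-(4 : ℝ) / 2) with hc
  set N : ℝ := ∫ x, (v x) ^ 2 * (Φ x) ^ 4 ∂μ with hN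
  set A : ℝ := ∫ x, (4 * (Φ x ^ 2 * g.gradSq v x) + r x * Φ x ^ 4 * v x ^ 2) ∂μ with hA
  set E : ℝ := ∫ x, (v x) ^ 2 * Real.log ((v x) ^ 2) * (Φ x) ^ 4 ∂μ with hE
  have hc0 : 0 < c := Real.rpow_pos_of_pos (by positivity) _
  have hIN : Integrable (fun x ↦ (v x) ^ 2 * (Φ x) ^ 4) μ :=
    EntropyLocalisation.integrable_of_continuous g hg (continuous_massForm hΦ.continuous hv.continuous)
  have hIE : Integrable (fun x ↦ (v x) ^ 2 * Real.log ((v x) ^ 2) * (Φ x) ^ 4) μ :=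
    EntropyLocalisation.integrable_of_continuous g hg (continuous_entForm hΦ.continuous hv.continuous)
  have hN0 : 0 ≤ N := integral_nonneg fun x ↦ by positivity
  have hA0 : 0 ≤ A := integral_nonneg fun x ↦ by have := g.gradSq_nonneg hg v x; have := hr0 x; positivity
  rcases hN0.eq_or_lt with hN00 | hNpos
  · -- `N = 0`: then `v = 0` a.e., the entropy part vanishes and the bound reads `0 ≤ θ τ c A`
    have hE0 : E = 0 := by
      have hae : (fun x ↦ (v x) ^ 2 * (Φ x) ^ 4) =ᵐ[μ] 0 :=
        (integral_eq_zero_iff_of_nonneg (fun x ↦ by positivity) hIN).1 hN00.symm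
      have hae' : (fun x ↦ (v x) ^ 2 * Real.log ((v x) ^ 2) * (Φ x) ^ 4) =ᵐ[μ] fun _ ↦ 0 := by
        filter_upwards [hae] with x hx
        have hv0 : v x = 0 := by
          rcases mul_eq_zero.1 hx with h | h
          · exact pow_eq_zero_iff two_ne_zero |>.1 h
          · exact absurd (pow_eq_zero_iff four_ne_zero |>.1 h) (hΦpos x).ne'
        simp [hv0]
      rw [hE, integral_congr_ae hae', integral_zero]
    rw [← hN00, hE0]; simp only [mul_zero, zero_mul, sub_zero, add_zero]; positivity
  · -- `N > 0`: normalise `u = k v`, `k = θ/√m`, at scale `θ τ`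
    have hm0 : 0 < c * N := mul_pos hc0 hNpos
    set k : ℝ := θ / Real.sqrt (c * N) with hk
    have hk2 : k ^ 2 = θ ^ 2 / (c * N) := by rw [hk, div_pow, Real.sq_sqrt hm0.le]
    set u : M → ℝ := fun x ↦ k * v x with hu
    have hus : ContMDiff (𝓡 4) 𝓘(ℝ, ℝ) ∞ u := contMDiff_const.mul hv
    have hsuppu : ∀ x, u x ≠ 0 → χ₀ x ≠ 0 := fun x hx ↦ hsupp x (mul_ne_zero_iff.1 hx).2
    have hcσ : (4 * Real.pi * (θ * τ)) ^ (-(4 : ℝ) / 2) = c / θ ^ 2 := WeightComparison.normConst_rescale hθ hτ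
    -- the scaled integrals
    have hNu : ∫ x, (u x) ^ 2 * (Φ x) ^ 4 ∂μ = k ^ 2 * N := by
      rw [hN, ← integral_const_mul]; exact integral_congr_ae (ae_of_all _ fun x ↦ by simp only [hu]; ring)
    have hAu : ∫ x, (4 * (Φ x ^ 2 * g.gradSq u x) + r x * Φ x ^ 4 * u x ^ 2) ∂μ = k ^ 2 * A := by
      rw [hA, ← integral_const_mul]
      refine integral_congr_ae (ae_of_all _ fun x ↦ ?_)
      have hgr : g.gradSq u x = k ^ 2 * g.gradSq v x := g.gradSq_const_mul v k x
      simp only [hu] at hgr ⊢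
      rw [hgr]; ring
    have hEu : ∫ x, (u x) ^ 2 * Real.log ((u x) ^ 2) * (Φ x) ^ 4 ∂μ = k ^ 2 * E + k ^ 2 * Real.log (k ^ 2) * N := by
      have h1 : ∀ x, (u x) ^ 2 * Real.log ((u x) ^ 2) * (Φ x) ^ 4 =
          k ^ 2 * ((v x) ^ 2 * Real.log ((v x) ^ 2) * (Φ x) ^ 4) + k ^ 2 * Real.log (k ^ 2) * ((v x) ^ 2 * (Φ x) ^ 4) := by
        intro x
        simp only [hu]
        rw [EntropyLocalisation.sq_mul_log_sq_mul k (v x)]; ring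
      rw [integral_congr_ae (ae_of_all _ h1), integral_add (hIE.const_mul _) (hIN.const_mul _), integral_const_mul, integral_const_mul]
    -- normalisation of `u` at scale `θ τ`, and the floor there
    have hnormu : ∫ x, (4 * Real.pi * (θ * τ)) ^ (-(4 : ℝ) / 2) * (u x) ^ 2 * (Φ x) ^ 4 ∂μ = 1 := by
      have h1 : ∫ x, c / θ ^ 2 * (u x) ^ 2 * (Φ x) ^ 4 ∂μ = c / θ ^ 2 * ∫ x, (u x) ^ 2 * (Φ x) ^ 4 ∂μ := by
        rw [← integral_const_mul]; exact integral_congr_ae (ae_of_all _ fun x ↦ by ring)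
      rw [hcσ, h1, hNu, hk2]; field_simp
    have hL := hfloor (θ * τ) (mul_pos hθ hτ) u hus hsuppu hnormu
    rw [hcσ, integral_density_split g hg hΦ hΦpos hr hus, hAu, hEu, hNu] at hL
    have hlogk : Real.log (k ^ 2) = 2 * Real.log θ - Real.log (c * N) := by
      rw [hk2, Real.log_div (pow_ne_zero _ hθ.ne') hm0.ne', Real.log_pow]; push_cast; ring
    rw [hlogk] at hL
    -- clear denominators: multiply the floor inequality by `m = c N > 0`
    have key : c * N * Lj ≤ θ * (τ * c * A) - c * E - c * N * (2 * Real.log θ - Real.log (c * N)) - 4 * (c * N) := by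
      have h := mul_le_mul_of_nonneg_left hL hm0.le
      have e : c * N * (θ * τ * (c / θ ^ 2) * (k ^ 2 * A) - c / θ ^ 2 *
            (k ^ 2 * E + k ^ 2 * (2 * Real.log θ - Real.log (c * N)) * N) - 4 * (c / θ ^ 2) * (k ^ 2 * N))
          = θ * (τ * c * A) - c * E - c * N * (2 * Real.log θ - Real.log (c * N)) - 4 * (c * N) := by
        rw [hk2]; field_simp; ring
      linarith [h, e]
    linarith [key]

/-- Finite IMS for the weighted Dirichlet–curvature form:
`Σᵢ ∫(4Φ²|∇(χᵢw)|² + rΦ⁴(χᵢw)²) = ∫(4Φ²|∇w|² + rΦ⁴w²) + 4 ∫ w²Φ² Σᵢ|∇χᵢ|²` for `Σᵢ χᵢ² = 1`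
(`EntropyLocalisationFinite.gradSq_localisation_sum`; Cycon–Froese–Kirsch–Simon 1987, Thm. 3.2). -/
theorem sum_quadForm (hg : g.IsRiemannian) {Φ r w : M → ℝ} {n : ℕ} {χ : Fin n → M → ℝ}
    (hΦ : ContMDiff (𝓡 4) 𝓘(ℝ, ℝ) ∞ Φ) (hr : Continuous r)
    (hχ : ∀ i, ContMDiff (𝓡 4) 𝓘(ℝ, ℝ) ∞ (χ i)) (hw : ContMDiff (𝓡 4) 𝓘(ℝ, ℝ) ∞ w)
    (h1 : ∀ y, ∑ i, χ i y ^ 2 = 1) :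
    ∑ i, ∫ x, (4 * (Φ x ^ 2 * g.gradSq (fun y ↦ χ i y * w y) x) + r x * Φ x ^ 4 * (χ i x * w x) ^ 2) ∂(riemannianMeasure (g.toContMDiffRiemannianMetric hg))
      = ∫ x, (4 * (Φ x ^ 2 * g.gradSq w x) + r x * Φ x ^ 4 * w x ^ 2) ∂(riemannianMeasure (g.toContMDiffRiemannianMetric hg))
        + 4 * ∫ x, w x ^ 2 * Φ x ^ 2 * (∑ i, g.gradSq (χ i) x) ∂(riemannianMeasure (g.toContMDiffRiemannianMetric hg)) := by
  set μ : Measure M := riemannianMeasure (g.toContMDiffRiemannianMetric hg)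
  have hpt : ∀ x, ∑ i, (4 * (Φ x ^ 2 * g.gradSq (fun y ↦ χ i y * w y) x) + r x * Φ x ^ 4 * (χ i x * w x) ^ 2)
      = (4 * (Φ x ^ 2 * g.gradSq w x) + r x * Φ x ^ 4 * w x ^ 2) + 4 * (w x ^ 2 * Φ x ^ 2 * ∑ i, g.gradSq (χ i) x) := by
    intro x
    have hI := EntropyLocalisationFinite.gradSq_localisation_sum g h1
      (fun i ↦ (hχ i x).mdifferentiableAt (by simp)) ((hw x).mdifferentiableAt (by simp))
    have e1 : ∑ i, 4 * (Φ x ^ 2 * g.gradSq (fun y ↦ χ i y * w y) x) = 4 * (Φ x ^ 2 * ∑ i, g.gradSq (fun y ↦ χ i y * w y) x) := by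
      rw [Finset.mul_sum, Finset.mul_sum]
    have e2 : ∑ i, r x * Φ x ^ 4 * (χ i x * w x) ^ 2 = r x * Φ x ^ 4 * w x ^ 2 * ∑ i, χ i x ^ 2 := by
      rw [Finset.mul_sum]
      exact Finset.sum_congr rfl fun i _ ↦ by ring
    rw [Finset.sum_add_distrib, e1, e2, hI, h1 x]; ring
  have hIi : ∀ i, Integrable (fun x ↦ 4 * (Φ x ^ 2 * g.gradSq (fun y ↦ χ i y * w y) x) + r x * Φ x ^ 4 * (χ i x * w x) ^ 2) μ :=
    fun i ↦ EntropyLocalisation.integrable_of_continuous g hg (continuous_quadForm g hΦ hr ((hχ i).mul hw))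
  have hIw : Integrable (fun x ↦ 4 * (Φ x ^ 2 * g.gradSq w x) + r x * Φ x ^ 4 * w x ^ 2) μ :=
    EntropyLocalisation.integrable_of_continuous g hg (continuous_quadForm g hΦ hr hw)
  have hIc : Integrable (fun x ↦ 4 * (w x ^ 2 * Φ x ^ 2 * ∑ i, g.gradSq (χ i) x)) μ := by
    refine (EntropyLocalisation.integrable_of_continuous g hg ?_).const_mul _
    exact ((hw.continuous.pow 2).mul (hΦ.continuous.pow 2)).mul (continuous_finsetSum _ fun i _ ↦ (contMDiff_gradSq g (hχ i)).continuous)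
  rw [← integral_finsetSum _ fun i _ ↦ hIi i, integral_congr_ae (ae_of_all _ hpt), integral_add hIw hIc, integral_const_mul]

omit [ChartedSpace (EuclideanSpace ℝ (Fin 4)) M] [IsManifold (𝓡 4) ∞ M] [T3Space M] in
/-- Splitting of the weighted entropy under a finite partition:
`Σᵢ ∫ (χᵢw)² log (χᵢw)² Φ⁴ = ∫ w² log w² Φ⁴ + Σᵢ ∫ w²Φ⁴ χᵢ² log χᵢ²` for `Σᵢ χᵢ² = 1`. -/
theorem sum_entForm {Φ w : M → ℝ} {n : ℕ} {χ : Fin n → M → ℝ} (hΦ : Continuous Φ)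
    (hχ : ∀ i, Continuous (χ i)) (hw : Continuous w) (h1 : ∀ y, ∑ i, χ i y ^ 2 = 1)
    (ν : Measure M) [IsFiniteMeasure ν] :
    ∑ i, ∫ x, (χ i x * w x) ^ 2 * Real.log ((χ i x * w x) ^ 2) * (Φ x) ^ 4 ∂ν
      = ∫ x, (w x) ^ 2 * Real.log ((w x) ^ 2) * (Φ x) ^ 4 ∂ν
        + ∑ i, ∫ x, (w x) ^ 2 * (Φ x) ^ 4 * (χ i x ^ 2 * Real.log (χ i x ^ 2)) ∂ν := by
  have hpt : ∀ x, ∑ i, (χ i x * w x) ^ 2 * Real.log ((χ i x * w x) ^ 2) * (Φ x) ^ 4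
      = (w x) ^ 2 * Real.log ((w x) ^ 2) * (Φ x) ^ 4 + ∑ i, (w x) ^ 2 * (Φ x) ^ 4 * (χ i x ^ 2 * Real.log (χ i x ^ 2)) := by
    intro x
    have e : ∀ i, (χ i x * w x) ^ 2 * Real.log ((χ i x * w x) ^ 2) * (Φ x) ^ 4 =
        (w x) ^ 2 * Real.log ((w x) ^ 2) * (Φ x) ^ 4 * χ i x ^ 2 + (w x) ^ 2 * (Φ x) ^ 4 * (χ i x ^ 2 * Real.log (χ i x ^ 2)) := by
      intro i
      rw [EntropyLocalisation.sq_mul_log_sq_mul (χ i x) (w x)]; ring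
    simp only [e, Finset.sum_add_distrib]
    rw [← Finset.mul_sum, h1 x, mul_one]
  have hIi : ∀ i, Integrable (fun x ↦ (χ i x * w x) ^ 2 * Real.log ((χ i x * w x) ^ 2) * (Φ x) ^ 4) ν :=
    fun i ↦ EntropyLocalisation.integrable_of_continuous_finite (continuous_entForm hΦ ((hχ i).mul hw)) ν
  have hIw : Integrable (fun x ↦ (w x) ^ 2 * Real.log ((w x) ^ 2) * (Φ x) ^ 4) ν :=
    EntropyLocalisation.integrable_of_continuous_finite (continuous_entForm hΦ hw) ν
  have hIX : ∀ i, Integrable (fun x ↦ (w x) ^ 2 * (Φ x) ^ 4 * (χ i x ^ 2 * Real.log (χ i x ^ 2))) ν := fun i ↦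
    EntropyLocalisation.integrable_of_continuous_finite ((continuous_massForm hΦ hw).mul (Real.continuous_mul_log.comp ((hχ i).pow 2))) ν
  rw [← integral_finsetSum _ fun i _ ↦ hIi i, integral_congr_ae (ae_of_all _ hpt),
    integral_add hIw (integrable_finsetSum _ fun i _ ↦ hIX i), integral_finsetSum _ fun i _ ↦ hIX i]

omit [ChartedSpace (EuclideanSpace ℝ (Fin 4)) M] [IsManifold (𝓡 4) ∞ M] [T3Space M] in
/-- The masses of the pieces add up: `Σᵢ ∫ (χᵢw)² Φ⁴ = ∫ w² Φ⁴` for `Σᵢ χᵢ² = 1`. -/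
theorem sum_massForm {Φ w : M → ℝ} {n : ℕ} {χ : Fin n → M → ℝ} (hΦ : Continuous Φ)
    (hχ : ∀ i, Continuous (χ i)) (hw : Continuous w) (h1 : ∀ y, ∑ i, χ i y ^ 2 = 1)
    (ν : Measure M) [IsFiniteMeasure ν] :
    ∑ i, ∫ x, (χ i x * w x) ^ 2 * (Φ x) ^ 4 ∂ν = ∫ x, (w x) ^ 2 * (Φ x) ^ 4 ∂ν := by
  have hpt : ∀ x, ∑ i, (χ i x * w x) ^ 2 * (Φ x) ^ 4 = (w x) ^ 2 * (Φ x) ^ 4 := by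
    intro x
    have e : ∀ i, (χ i x * w x) ^ 2 * (Φ x) ^ 4 = (w x) ^ 2 * (Φ x) ^ 4 * χ i x ^ 2 := fun i ↦ by ring
    simp only [e]
    rw [← Finset.mul_sum, h1 x, mul_one]
  have hIi : ∀ i, Integrable (fun x ↦ (χ i x * w x) ^ 2 * (Φ x) ^ 4) ν :=
    fun i ↦ EntropyLocalisation.integrable_of_continuous_finite (continuous_massForm hΦ ((hχ i).mul hw)) ν
  rw [← integral_finsetSum _ fun i _ ↦ hIi i, integral_congr_ae (ae_of_all _ hpt)]

/-- **Mixing entropy is paid by convexity (Jensen), weighted form**: for the probability measure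
`c w² Φ⁴ dV`, `m log m ≤ c ∫ w²Φ⁴ χ² log χ²` with `m = c ∫ (χ w)² Φ⁴`. -/
theorem mass_mul_log_le (hg : g.IsRiemannian) {Φ w χ₀ : M → ℝ} (hΦ : Continuous Φ)
    (hw : Continuous w) (hχ₀ : Continuous χ₀) {c : ℝ} (hc : 0 ≤ c)
    (hnorm : ∫ x, c * (w x) ^ 2 * (Φ x) ^ 4 ∂(riemannianMeasure (g.toContMDiffRiemannianMetric hg)) = 1) :
    (c * ∫ x, (χ₀ x * w x) ^ 2 * (Φ x) ^ 4 ∂(riemannianMeasure (g.toContMDiffRiemannianMetric hg))) *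
        Real.log (c * ∫ x, (χ₀ x * w x) ^ 2 * (Φ x) ^ 4 ∂(riemannianMeasure (g.toContMDiffRiemannianMetric hg)))
      ≤ c * ∫ x, (w x) ^ 2 * (Φ x) ^ 4 * (χ₀ x ^ 2 * Real.log (χ₀ x ^ 2)) ∂(riemannianMeasure (g.toContMDiffRiemannianMetric hg)) := by
  set μ : Measure M := riemannianMeasure (g.toContMDiffRiemannianMetric hg)
  have hW : Continuous fun x ↦ w x * Φ x ^ 2 := hw.mul (hΦ.pow 2)
  have hnorm' : ∫ x, c * (w x * Φ x ^ 2) ^ 2 ∂μ = 1 := by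
    rw [← hnorm]; exact integral_congr_ae (ae_of_all _ fun x ↦ by ring)
  have hJ := EntropyLocalisation.mul_log_le_integral_of_sq_density g hg hW hχ₀ hc hnorm'
  have e1 : ∫ x, c * (w x * Φ x ^ 2) ^ 2 * χ₀ x ^ 2 ∂μ = c * ∫ x, (χ₀ x * w x) ^ 2 * (Φ x) ^ 4 ∂μ := by
    rw [← integral_const_mul]; exact integral_congr_ae (ae_of_all _ fun x ↦ by ring)
  have e2 : ∫ x, c * (w x * Φ x ^ 2) ^ 2 * (χ₀ x ^ 2 * Real.log (χ₀ x ^ 2)) ∂μ =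
      c * ∫ x, (w x) ^ 2 * (Φ x) ^ 4 * (χ₀ x ^ 2 * Real.log (χ₀ x ^ 2)) ∂μ := by
    rw [← integral_const_mul]; exact integral_congr_ae (ae_of_all _ fun x ↦ by ring)
  rwa [e1, e2] at hJ

end Integral

end LocalisationPrincipleAux

open LocalisationPrincipleAux in
/-- L1: **localisation principle** (registered helper `helper_localisationPrinciple`, line
`fat-conical-core-avr-logsobolev`, crux stmt-SmoothPoincare4-10871). If `Σⱼ χⱼ² = 1`, the cut-off
cost is absorbed by a fraction `β < 1` of the weighted Dirichlet–curvature form, and each piece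
satisfies the weighted clause at level `Lⱼ` at every scale for test functions living where
`χⱼ ≠ 0`, then the whole weighted clause holds at level `minⱼ Lⱼ + 2 log(1 − β)` (finite IMS +
Jensen + the scale shift `τ ↦ (1−β)τ`; see the module docstring). Cycon–Froese–Kirsch–Simon 1987,
Thm. 3.2; Perelman 2002, §3. -/
theorem helper_localisationPrinciple :
    ∀ (M : Type) [TopologicalSpace M] [T2Space M] [SecondCountableTopology M]
      [ChartedSpace (EuclideanSpace ℝ (Fin 4)) M] [IsManifold (𝓡 4) ∞ M] [CompactSpace M]
      [T3Space M] [MeasurableSpace M] [BorelSpace M]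
      (g : PseudoRiemannianMetric (𝓡 4) ∞ (EuclideanSpace ℝ (Fin 4)) (TangentSpace (𝓡 4) : M → Type _))
      [g.HasLeviCivita] (hg : g.IsRiemannian) (Φ r : M → ℝ) (n : ℕ) (χ : Fin (n + 1) → M → ℝ)
      (L : Fin (n + 1) → ℝ) (β : ℝ),
      ContMDiff (𝓡 4) 𝓘(ℝ, ℝ) ∞ Φ → (∀ x, 0 < Φ x) → Continuous r → (∀ x, 0 ≤ r x) →
      (∀ j, ContMDiff (𝓡 4) 𝓘(ℝ, ℝ) ∞ (χ j)) → (∀ x, ∑ j, χ j x ^ 2 = 1) → 0 ≤ β → β < 1 →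
      (∀ u : M → ℝ, ContMDiff (𝓡 4) 𝓘(ℝ, ℝ) ∞ u →
        4 * ∫ x, u x ^ 2 * Φ x ^ 2 * (∑ j, g.gradSq (χ j) x)
            ∂(riemannianMeasure (g.toContMDiffRiemannianMetric hg)) ≤
          β * ∫ x, (4 * (Φ x ^ 2 * g.gradSq u x) + r x * Φ x ^ 4 * u x ^ 2)
            ∂(riemannianMeasure (g.toContMDiffRiemannianMetric hg))) →
      (∀ (j : Fin (n + 1)) (σ : ℝ), 0 < σ → ∀ v : M → ℝ, ContMDiff (𝓡 4) 𝓘(ℝ, ℝ) ∞ v →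
        (∀ x, v x ≠ 0 → χ j x ≠ 0) →
        ∫ x, (4 * Real.pi * σ) ^ (-(4 : ℝ) / 2) * (v x) ^ 2 * (Φ x) ^ 4
            ∂(riemannianMeasure (g.toContMDiffRiemannianMetric hg)) = 1 →
          L j ≤ ∫ x, (σ * (r x * (v x) ^ 2 + 4 * ((Φ x)⁻¹ ^ 2 * g.gradSq v x))
              - (v x) ^ 2 * Real.log ((v x) ^ 2) - 4 * (v x) ^ 2)
              * ((4 * Real.pi * σ) ^ (-(4 : ℝ) / 2) * (Φ x) ^ 4)
            ∂(riemannianMeasure (g.toContMDiffRiemannianMetric hg))) →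
      ∀ τ : ℝ, 0 < τ → ∀ w : M → ℝ, ContMDiff (𝓡 4) 𝓘(ℝ, ℝ) ∞ w →
        ∫ x, (4 * Real.pi * τ) ^ (-(4 : ℝ) / 2) * (w x) ^ 2 * (Φ x) ^ 4
            ∂(riemannianMeasure (g.toContMDiffRiemannianMetric hg)) = 1 →
          (Finset.univ.inf' Finset.univ_nonempty L) + 2 * Real.log (1 - β) ≤
            ∫ x, (τ * (r x * (w x) ^ 2 + 4 * ((Φ x)⁻¹ ^ 2 * g.gradSq w x))
                - (w x) ^ 2 * Real.log ((w x) ^ 2) - 4 * (w x) ^ 2)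
                * ((4 * Real.pi * τ) ^ (-(4 : ℝ) / 2) * (Φ x) ^ 4)
              ∂(riemannianMeasure (g.toContMDiffRiemannianMetric hg)) := by
  intro M _ _ _ _ _ _ _ _ _ g _ hg Φ r n χ L β hΦ hΦpos hr hr0 hχ h1 hβ0 hβ1 habs hfloor τ hτ w hw hnorm
  set μ : Measure M := riemannianMeasure (g.toContMDiffRiemannianMetric hg) with hμ
  set c : ℝ := (4 * Real.pi * τ) ^ (-(4 : ℝ) / 2) with hc
  have hc0 : 0 < c := Real.rpow_pos_of_pos (by positivity) _
  have hθ0 : 0 < 1 - β := by linarith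
  have hΦc : Continuous Φ := hΦ.continuous
  have hwc : Continuous w := hw.continuous
  have hχc : ∀ j, Continuous (χ j) := fun j ↦ (hχ j).continuous
  haveI : IsFiniteMeasure μ := isFiniteMeasure_riemannianMeasure _
  -- the pieces `χⱼ w`
  have hv : ∀ j, ContMDiff (𝓡 4) 𝓘(ℝ, ℝ) ∞ (fun y ↦ χ j y * w y) := fun j ↦ (hχ j).mul hw
  have hsupp : ∀ (j : Fin (n + 1)) (x : M), χ j x * w x ≠ 0 → χ j x ≠ 0 := fun j x hx ↦ (mul_ne_zero_iff.1 hx).1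
  -- (F1) splitting of the functional of `w`
  have F1 := integral_density_split g hg hΦ hΦpos hr hw τ c
  -- (F2)-(F4) the pieces add up (finite IMS, entropy splitting, masses)
  have F2 := sum_quadForm g hg (r := r) hΦ hr hχ hw h1
  have F3 := sum_entForm (Φ := Φ) hΦc hχc hwc h1 μ
  have F4 := sum_massForm (Φ := Φ) hΦc hχc hwc h1 μ
  -- (F5) normalisation
  have F5 : c * ∫ x, (w x) ^ 2 * (Φ x) ^ 4 ∂μ = 1 := by
    rw [← hnorm, ← integral_const_mul]; exact integral_congr_ae (ae_of_all _ fun x ↦ by ring)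
  -- (F6) Jensen for the mixing entropy
  have F6 : ∀ j : Fin (n + 1),
      (c * ∫ x, (χ j x * w x) ^ 2 * (Φ x) ^ 4 ∂μ) * Real.log (c * ∫ x, (χ j x * w x) ^ 2 * (Φ x) ^ 4 ∂μ)
        ≤ c * ∫ x, (w x) ^ 2 * (Φ x) ^ 4 * (χ j x ^ 2 * Real.log (χ j x ^ 2)) ∂μ :=
    fun j ↦ mass_mul_log_le g hg hΦc hwc (hχc j) hc0.le hnorm
  -- (F7)-(F8) absorption of the cut-off cost
  have F7 := habs w hw
  have F8 : 0 ≤ ∫ x, w x ^ 2 * Φ x ^ 2 * (∑ j, g.gradSq (χ j) x) ∂μ :=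
    integral_nonneg fun x ↦ mul_nonneg (by positivity) (Finset.sum_nonneg fun j _ ↦ g.gradSq_nonneg hg (χ j) x)
  -- (F9) the per-piece bounds with the scale shift
  have F9 : ∀ j : Fin (n + 1),
      (c * ∫ x, (χ j x * w x) ^ 2 * (Φ x) ^ 4 ∂μ) * (L j + 2 * Real.log (1 - β)) ≤
        (1 - β) * (τ * c * ∫ x, (4 * (Φ x ^ 2 * g.gradSq (fun y ↦ χ j y * w y) x) + r x * Φ x ^ 4 * (χ j x * w x) ^ 2) ∂μ)
          - c * ∫ x, (χ j x * w x) ^ 2 * Real.log ((χ j x * w x) ^ 2) * (Φ x) ^ 4 ∂μ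
          - 4 * (c * ∫ x, (χ j x * w x) ^ 2 * (Φ x) ^ 4 ∂μ)
          + (c * ∫ x, (χ j x * w x) ^ 2 * (Φ x) ^ 4 ∂μ) * Real.log (c * ∫ x, (χ j x * w x) ^ 2 * (Φ x) ^ 4 ∂μ) :=
    fun j ↦ piece_bound g hg hΦ hΦpos hr hr0 (hv j) (hsupp j) hτ hθ0 (hfloor j)
  -- (F10)-(F11) masses are non-negative, levels are above the minimum
  have F10 : ∀ j : Fin (n + 1), 0 ≤ c * ∫ x, (χ j x * w x) ^ 2 * (Φ x) ^ 4 ∂μ :=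
    fun j ↦ mul_nonneg hc0.le (integral_nonneg fun x ↦ by positivity)
  have F11 : ∀ j : Fin (n + 1), Finset.univ.inf' Finset.univ_nonempty L ≤ L j := fun j ↦ Finset.inf'_le L (Finset.mem_univ j)
  -- summation over the pieces
  have S1 := Finset.sum_le_sum fun j (_ : j ∈ Finset.univ) ↦ F9 j
  have S2 := Finset.sum_le_sum fun j (_ : j ∈ Finset.univ) ↦ F6 j
  have S3 : ∑ j, (c * ∫ x, (χ j x * w x) ^ 2 * (Φ x) ^ 4 ∂μ) * (Finset.univ.inf' Finset.univ_nonempty L + 2 * Real.log (1 - β))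
      ≤ ∑ j, (c * ∫ x, (χ j x * w x) ^ 2 * (Φ x) ^ 4 ∂μ) * (L j + 2 * Real.log (1 - β)) :=
    Finset.sum_le_sum fun j _ ↦ mul_le_mul_of_nonneg_left (by linarith [F11 j]) (F10 j)
  have S4 : ∑ j, (c * ∫ x, (χ j x * w x) ^ 2 * (Φ x) ^ 4 ∂μ) = 1 := by
    rw [← Finset.mul_sum, F4, F5]
  rw [← Finset.sum_mul, S4, one_mul] at S3
  simp only [Finset.sum_add_distrib, Finset.sum_sub_distrib, ← Finset.mul_sum] at S1 S2
  rw [F2, F3, F4] at S1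
  rw [F1]
  -- linear bookkeeping: `cost ≤ β A(w) ≤ β Σⱼ A(χⱼ w)`, multiplied by `τ c`
  have G1 : 4 * (∫ x, w x ^ 2 * Φ x ^ 2 * (∑ j, g.gradSq (χ j) x) ∂μ) ≤
      β * ((∫ x, (4 * (Φ x ^ 2 * g.gradSq w x) + r x * Φ x ^ 4 * w x ^ 2) ∂μ) + 4 * ∫ x, w x ^ 2 * Φ x ^ 2 * (∑ j, g.gradSq (χ j) x) ∂μ) := by
    nlinarith [F7, F8, hβ0]
  have G2 := mul_le_mul_of_nonneg_left G1 (mul_pos hτ hc0).le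
  nlinarith [S1, S2, S3, G2, F5, hc0, hτ]

end Summit.SmoothPoincare4.SmoothPoincare4.Theorems

end
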